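import Summits.BirchSwinnertonDyer.BirchSwinnertonDyer.Theorems.PrintCf2DisegniPairTwoTameBranchBaseCurrency
import Summits.BirchSwinnertonDyer.BirchSwinnertonDyer.Theorems.PrintCf2DisegniPairTwoTamePeriodTransportNegCm7
import HarnessLib

/-!
# Road (C) `disegni-pair-two` on crux stmt-BirchSwinnertonDyer-20368 — the ODD-class defect keys (`χ₋₄∘N`, `χ₋₈∘N`) in
# `cm7`-currency: NO class constant (both signs of the twist parameter)

Cell `bsd-print-cf2`, width seat `bsd-line-cf2-p1-w8` g24; odd-class twin of `defectKey_chi8_cm7_currency[_neg]`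
(`PrintCf2DisegniPairTwoTamePeriodTransport[Neg]Cm7.lean`; memo `Cruxes/SplitBadTwoRankOneOfFacts/PERIOD-CANCELS-w8g24.md` §8, step G7).
`--supports stmt-BirchSwinnertonDyer-20368` (helper). THEOREMS ONLY (no `def`, no named fact, no `sorry`); conditional on every
displayed hypothesis — the anchor print `OptimalCurveManinCertificate cm7`, modularity `exists_isNewformOf`, the PRINT stub
`ChiLineGrossZagierClauses` and (Δ1) exactly as the keys it rewrites. BSD is not proved here; no summit statement is claimed;
20368 is not closed here.

## What is proved

For the crux every good curve is `V = C₀ • cm7^{(d)}` (`d ≡ 1 (4)` squarefree, prime to `7`, either sign). Specialising the base-currency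
keys of `…TameBranchBaseCurrency.lean` to `E = cm7` and discharging the base data — `μ(cm7) = 1`
(`imaginaryPeriodRat_cm7_eq_minusPeriod`, for `d > 0`), `ϖ(cm7) = 1` (`realPeriodRat_cm7_eq_plusPeriod`) and `c_∞(cm7) = 1`
(`padicValRat_numRealComponents_cm7`, for `d < 0`), `u(C₀) = ±1` (`padicValRat_u_cm7_twist_eq_zero`, Pal Prop. 2.5), `Δ(V) < 0`
(`Δ_neg_of_smul_eq_quadraticTwist`):

* ★★★ `defectKey_chi4_cm7_currency` / `defectKey_chi4_cm7_currency_neg` (`χ₋₄` object `[T¹]G`),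
* ★★★ `defectKey_chi8'_cm7_currency` / `defectKey_chi8'_cm7_currency_neg` (`χ₋₈` object `Σ_k k[T^k]G(−2)^{k−1}`):
  `D_G ≠ 0 ∧ shaAn W = q ∈ ℚˣ ∧ v₂(q) + v₂(Tam W) + v₂(h₂) = v₂(D_G) + 2 + 2v₂(#W(ℚ)_tors)` — NO period ratio, NO Birch constant,
  NO `u(C₀)`, NO `c_∞`: together with `defectKey_chi8_cm7_currency[_neg]` this covers all three non-trivial classes `χ₈∘N`, `χ₋₄∘N`,
  `χ₋₈∘N` over every good twist of `cm7`, in the currency of the FIXED level-`49` form. What remains per class is the (Δ1) law for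
  `v₂(D_G) − v₂(h₂)` and the print stub.

References: D. Disegni, Compos. Math. 153 (2017) Thm. B [Disegni2017]; B. Mazur, J. Tate, J. Teitelbaum, Invent. Math. 84 (1986) §I.8, §I.13
[MazurTateTeitelbaum1986Invent]; V. Pal, Proc. AMS 140 (2012) Prop. 2.5, Thm. 3.2 [Pal2012]; A. Agashe, K. Ribet, W. Stein, Pure Appl.
Math. Q. 2 (2006) [AgasheRibetStein2006].
-/

set_option autoImplicit false
set_option linter.dupNamespace false

noncomputable section

open scoped Classical MatrixGroups ModularForm NumberField NumberTheorySymbols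

open CongruenceSubgroup NumberField IsDedekindDomain WeierstrassCurve WeierstrassCurve.Affine.Point PowerSeries
  Literature.NumberTheory.EllipticCurves Literature.NumberTheory.EllipticCurves.ModularForms
  Literature.NumberTheory.EllipticCurves.Disegni2017 Literature.NumberTheory.GaloisRepresentations
  Literature.NumberTheory.EllipticCurves.GreenbergVatsal2000 Summit.BirchSwinnertonDyer.Rank1Residual.AdditivePotMult

namespace Summit.BirchSwinnertonDyer.BirchSwinnertonDyer.Theorems.PrintCf2.DisegniPairTwo

variable (ι : PadicAlgCl 2 ≃+* ℂ) (K : Type) [Field K] [NumberField K] [IsGalois ℚ K]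

/-! ### The `χ₋₄∘N`-class in `cm7`-currency -/

/-- ★★★ **The defect key of the `χ₋₄∘N`-class MODULO (Δ1), in `cm7`-currency, with NO class constant, `d > 0`.** Frame of
`defectKey_chi4_modulo_descent_min_of_Δ_neg` for a globally minimal member `W` over the good curve `V = C₀ • cm7^{(d)}` (`d > 0`,
`d ≡ 1 (mod 4)`, squarefree, prime to `7`), GRANTED the anchor print `OptimalCurveManinCertificate cm7` (`μ(cm7) = 1`,
`imaginaryPeriodRat_cm7_eq_minusPeriod`) and modularity `exists_isNewformOf`: with `G = L⁻₂(f_{cm7}, d, α_{cm7}, ωχ_d, ·)` the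
`ω`-branch of the `χ_d`-twisted MINUS tame transform of the level-`49` newform,
`[T¹]G ≠ 0 ∧ shaAn W = q ∈ ℚˣ ∧ v₂(q) + v₂(Tam W) + v₂(h₂) = v₂([T¹]G) + 2 + 2v₂(#W(ℚ)_tors)`.
The minus period ratio of `V`, Pal's `u(C₀)` and `c_∞(V)` are all discharged; what remains is (Δ1) for `v₂([T¹]G) − v₂(h₂)` and the
print stub. [cite: Disegni2017, Theorem B] [cite: MazurTateTeitelbaum1986Invent, §I.8 and §I.13] [cite: Pal2012, Prop. 2.5, Thm. 3.2]
[cite: AgasheRibetStein2006, Thm. 2.6 and appendix §5] -/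
theorem defectKey_chi4_cm7_currency (hGZ73 : GrossZagier1986_thm_I_7_3) (h2 : Module.finrank ℚ K = 2)
    (hsplit : ((Ideal.span {(2 : ℤ)}).primesOver (𝓞 K)).ncard = 2)
    (𝔭 𝔭' : HeightOneSpectrum (𝓞 K)) (h𝔭 : ((2 : ℕ) : 𝓞 K) ∈ 𝔭.asIdeal)
    (h𝔭' : ((2 : ℕ) : 𝓞 K) ∈ 𝔭'.asIdeal)
    (κ : DirichletCharacter ℂ (NumberField.discr K).natAbs)
    (hκ : ∀ ℓ : ℕ, ℓ.Prime → ℓ ≠ 2 → κ ℓ = (jacobiSym (NumberField.discr K) ℓ : ℂ))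
    (hκ2 : κ 2 = if NumberField.discr K % 8 = 1 then 1 else if NumberField.discr K % 8 = 5 then -1 else 0)
    (hd : Nat.Coprime 2 (NumberField.discr K).natAbs)
    -- the base `cm7`: anchor print, newform, and the twist parameter `d`
    [cm7.IsGloballyMinimal] [NeZero (cm7.conductorNorm ℤ)] (hM : OptimalCurveManinCertificate cm7)
    {fE : CuspForm (Gamma0 (cm7.conductorNorm ℤ)) 2} (hfE : IsNewformOf cm7 fE)
    (hmodf : exists_isNewformOf) {d : ℤ} [NeZero d.natAbs] (hd0 : 0 < d) (hd4 : d % 4 = 1) (hsq : Squarefree d)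
    (hcop : IsCoprime d (cm7.conductorNorm ℤ : ℤ)) (h7 : ¬ (7 : ℤ) ∣ d) {χJ : MulChar (ZMod d.natAbs) ℤ}
    (hχJ : ∀ a : ZMod d.natAbs, χJ a = J((a.val : ℤ) | d.natAbs))
    -- the good pair over `V = C₀ • cm7^{(d)}`
    (V V' : WeierstrassCurve ℚ) [V.IsElliptic] [V.IsGloballyMinimal] [V'.IsElliptic] [V'.IsGloballyMinimal]
    [NeZero (V.conductorNorm ℤ)] {C₀ : VariableChange ℚ} (hV : C₀ • cm7.quadraticTwist (d : ℚ) = V)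
    (hordV' : IsOrdinaryAt V' 2) (hap : V'.frobeniusTrace 2 = V.frobeniusTrace 2)
    {N' : ℕ} [NeZero N'] {f : CuspForm (Gamma0 (V.conductorNorm ℤ)) 2}
    {f' : CuspForm (Gamma0 N') 2} (hfV : IsNewformOf V f) (hfV' : IsNewformOf V' f')
    (hV' : ∀ n : ℕ, cuspCoeff f' n = κ (n : ZMod _) * cuspCoeff f n)
    (h0 : PowerSeries.constantCoeff (padicLFunctionMinusBranch f (unitRoot V 2 : ℚ_[2]) 1) = 0)
    (hmod : hasEntireLFunction_rat) {M M' : ℕ} [NeZero M] [NeZero M']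
    {g : CuspForm (Gamma0 M) 2} {g' : CuspForm (Gamma0 M') 2}
    (W W' : WeierstrassCurve ℚ) [W.IsElliptic] [W.IsGloballyMinimal] [W'.IsElliptic]
    (hg : IsNewformOf W g) (hg' : IsNewformOf W' g')
    (hgε : ∀ m : ℕ, cuspCoeff g m = (ZMod.χ₄.ringHomComp (Int.castRingHom ℂ)) m * cuspCoeff f m)
    (hg'ε : ∀ m : ℕ, cuspCoeff g' m = (ZMod.χ₄.ringHomComp (Int.castRingHom ℂ)) m * cuspCoeff f' m)
    (hr : W.analyticRank = 1) (hrk : W.mordellWeilRank = 1) (hL' : W'.entireLFunction 1 ≠ 0)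
    {H : Type} [Field H] [NumberField H] [Algebra K H] (hKH : Module.finrank K H = 2) {t : H}
    (htK : t ∉ Set.range (algebraMap K H)) (ht2 : t ^ 2 = algebraMap ℚ H (-1))
    (G : Subgroup (H ≃ₐ[ℚ] H)) (χ : G →* ℂˣ) (s : G → ℤ) (hs : ∀ σ, ((χ σ : ℂˣ) : ℂ) = (s σ : ℂ))
    (τ : H ≃ₐ[ℚ] H) (hτG : τ ∈ G) (hsτ : s ⟨τ, hτG⟩ = -1)
    (hτK : ∀ a : K, τ (algebraMap K H a) = algebraMap K H a) (hτt : τ t = -t)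
    {u : K} {e : ℚ} (hu : u ∉ Set.range (algebraMap ℚ K)) (hue : u ^ 2 = algebraMap ℚ K e)
    (c : K ≃ₐ[ℚ] K) (hcu : c u = -u)
    [(V.quadraticTwist (-1)).IsElliptic] {C : VariableChange ℚ} (hC : C • W = V.quadraticTwist (-1))
    {P : (V.quadraticTwist (-1)).toAffine.Point}
    (hgen : ∀ R : (V.quadraticTwist (-1)).toAffine.Point,
      ∃ (k : ℤ) (T : (V.quadraticTwist (-1)).toAffine.Point), IsOfFinAddOrder T ∧ R = k • P + T)
    (htors : ∀ Q : ((V.quadraticTwist (-1)).quadraticTwist e).toAffine.Point, IsOfFinAddOrder Q)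
    (DH : PAdicHeightDataK V 2 H)
    (hDH : ∀ (σ : G) (a b : (V.baseChange H).toAffine.Point),
      DH.pairing (pointGalHom V H σ.1 a) (pointGalHom V H σ.1 b) = DH.pairing a b)
    {h₂ : ℚ_[2]}
    (hpin : DH.pairing
      (twistPointEquivOver V (not_mem_range_rat_of_not_mem_range htK) ht2
        (QuadraticDescent.incl H (V.quadraticTwist (-1)) P))
      (twistPointEquivOver V (not_mem_range_rat_of_not_mem_range htK) ht2
        (QuadraticDescent.incl H (V.quadraticTwist (-1)) P)) = h₂)
    (hGZ : ChiLineGrossZagierClauses ι K V H f (ι (((unitRoot V 2 : ℚ_[2]) : PadicAlgCl 2)))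
      (baseChangeDirichlet K (ZMod.χ₄.ringHomComp (Int.castRingHom ℂ))) 𝔭 𝔭' G χ DH)
    (hh₂ : h₂ ≠ 0) :
    (PowerSeries.coeff 1 (padicLFunctionTameMinusBranch fE d.natAbs (unitRoot cm7 2 : ℚ_[2])
          ((χJ.ringHomComp (Int.castRingHom ℚ)).ringHomComp (Rat.castHom ℚ_[2])) 1)) ≠ 0 ∧
    ∃ q : ℚ, shaAn W = (q : ℂ) ∧ q ≠ 0 ∧
      padicValRat 2 q + (padicValNat 2 W.tamagawaProduct : ℤ) + h₂.valuation =
        (PowerSeries.coeff 1 (padicLFunctionTameMinusBranch fE d.natAbs (unitRoot cm7 2 : ℚ_[2])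
          ((χJ.ringHomComp (Int.castRingHom ℚ)).ringHomComp (Rat.castHom ℚ_[2])) 1)).valuation + 2 +
          2 * (padicValNat 2 W.torsionOrder : ℤ) := by
  have hordE : IsOrdinaryAt cm7 2 := ⟨cm7_hasGoodReductionAtPrime_two, cm7_not_two_dvd_frobeniusTrace_two⟩
  have hμE := imaginaryPeriodRat_cm7_eq_minusPeriod hM hfE
  have hdQ : ((d : ℚ)) ≠ 0 := by exact_mod_cast hd0.ne'
  have hΔ : V.Δ < 0 := Δ_neg_of_smul_eq_quadraticTwist cm7 V (by rw [Δ_cm7]; norm_num) hdQ hV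
  obtain ⟨hDG, q, hq, hq0, hv⟩ := defectKey_chi4_base_currency ι K hGZ73 h2 hsplit 𝔭 𝔭' h𝔭 h𝔭' κ hκ hκ2 hd cm7 hfE
    hordE hmodf hd0 hd4 hsq hcop hχJ one_ne_zero hμE V V' hV hΔ hordV' hap hfV hfV' hV' h0 hmod W W' hg hg' hgε hg'ε hr
    hrk hL' hKH htK ht2 G χ s hs τ hτG hsτ hτK hτt hu hue c hcu hC hgen htors DH hDH hpin hGZ hh₂
  have hu0 : padicValRat 2 (C₀.u : ℚ) = 0 := padicValRat_u_cm7_twist_eq_zero hd4 hsq h7 V hV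
  refine ⟨hDG, q, hq, hq0, ?_⟩
  rw [hu0, add_zero, padicValRat.one, add_zero] at hv
  exact hv

/-- ★★★ **The defect key of the `χ₋₄∘N`-class MODULO (Δ1), in `cm7`-currency, with NO class constant, `d < 0`** (`G` = the
`ω`-branch of the `χ_d`-twisted PLUS tame transform of `f_{cm7}`; `ϖ(cm7) = 1`, `c_∞(cm7) = 1`, `u(C₀) = ±1` discharged):
`[T¹]G ≠ 0 ∧ shaAn W = q ∈ ℚˣ ∧ v₂(q) + v₂(Tam W) + v₂(h₂) = v₂([T¹]G) + 2 + 2v₂(#W(ℚ)_tors)`.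
[cite: Disegni2017, Theorem B] [cite: MazurTateTeitelbaum1986Invent, §I.8 and §I.13] [cite: Pal2012, Prop. 2.5, Thm. 3.2]
[cite: AgasheRibetStein2006, Thm. 2.6 and appendix §5] -/
theorem defectKey_chi4_cm7_currency_neg (hGZ73 : GrossZagier1986_thm_I_7_3) (h2 : Module.finrank ℚ K = 2)
    (hsplit : ((Ideal.span {(2 : ℤ)}).primesOver (𝓞 K)).ncard = 2)
    (𝔭 𝔭' : HeightOneSpectrum (𝓞 K)) (h𝔭 : ((2 : ℕ) : 𝓞 K) ∈ 𝔭.asIdeal)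
    (h𝔭' : ((2 : ℕ) : 𝓞 K) ∈ 𝔭'.asIdeal)
    (κ : DirichletCharacter ℂ (NumberField.discr K).natAbs)
    (hκ : ∀ ℓ : ℕ, ℓ.Prime → ℓ ≠ 2 → κ ℓ = (jacobiSym (NumberField.discr K) ℓ : ℂ))
    (hκ2 : κ 2 = if NumberField.discr K % 8 = 1 then 1 else if NumberField.discr K % 8 = 5 then -1 else 0)
    (hd : Nat.Coprime 2 (NumberField.discr K).natAbs)
    -- the base `cm7`: anchor print, newform, and the twist parameter `d`
    [cm7.IsGloballyMinimal] [NeZero (cm7.conductorNorm ℤ)] (hM : OptimalCurveManinCertificate cm7)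
    {fE : CuspForm (Gamma0 (cm7.conductorNorm ℤ)) 2} (hfE : IsNewformOf cm7 fE)
    (hmodf : exists_isNewformOf) {d : ℤ} [NeZero d.natAbs] (hd0 : d < 0) (hd4 : d % 4 = 1) (hsq : Squarefree d)
    (hcop : IsCoprime d (cm7.conductorNorm ℤ : ℤ)) (h7 : ¬ (7 : ℤ) ∣ d) {χJ : MulChar (ZMod d.natAbs) ℤ}
    (hχJ : ∀ a : ZMod d.natAbs, χJ a = J((a.val : ℤ) | d.natAbs))
    -- the good pair over `V = C₀ • cm7^{(d)}`
    (V V' : WeierstrassCurve ℚ) [V.IsElliptic] [V.IsGloballyMinimal] [V'.IsElliptic] [V'.IsGloballyMinimal]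
    [NeZero (V.conductorNorm ℤ)] {C₀ : VariableChange ℚ} (hV : C₀ • cm7.quadraticTwist (d : ℚ) = V)
    (hordV' : IsOrdinaryAt V' 2) (hap : V'.frobeniusTrace 2 = V.frobeniusTrace 2)
    {N' : ℕ} [NeZero N'] {f : CuspForm (Gamma0 (V.conductorNorm ℤ)) 2}
    {f' : CuspForm (Gamma0 N') 2} (hfV : IsNewformOf V f) (hfV' : IsNewformOf V' f')
    (hV' : ∀ n : ℕ, cuspCoeff f' n = κ (n : ZMod _) * cuspCoeff f n)
    (h0 : PowerSeries.constantCoeff (padicLFunctionMinusBranch f (unitRoot V 2 : ℚ_[2]) 1) = 0)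
    (hmod : hasEntireLFunction_rat) {M M' : ℕ} [NeZero M] [NeZero M']
    {g : CuspForm (Gamma0 M) 2} {g' : CuspForm (Gamma0 M') 2}
    (W W' : WeierstrassCurve ℚ) [W.IsElliptic] [W.IsGloballyMinimal] [W'.IsElliptic]
    (hg : IsNewformOf W g) (hg' : IsNewformOf W' g')
    (hgε : ∀ m : ℕ, cuspCoeff g m = (ZMod.χ₄.ringHomComp (Int.castRingHom ℂ)) m * cuspCoeff f m)
    (hg'ε : ∀ m : ℕ, cuspCoeff g' m = (ZMod.χ₄.ringHomComp (Int.castRingHom ℂ)) m * cuspCoeff f' m)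
    (hr : W.analyticRank = 1) (hrk : W.mordellWeilRank = 1) (hL' : W'.entireLFunction 1 ≠ 0)
    {H : Type} [Field H] [NumberField H] [Algebra K H] (hKH : Module.finrank K H = 2) {t : H}
    (htK : t ∉ Set.range (algebraMap K H)) (ht2 : t ^ 2 = algebraMap ℚ H (-1))
    (G : Subgroup (H ≃ₐ[ℚ] H)) (χ : G →* ℂˣ) (s : G → ℤ) (hs : ∀ σ, ((χ σ : ℂˣ) : ℂ) = (s σ : ℂ))
    (τ : H ≃ₐ[ℚ] H) (hτG : τ ∈ G) (hsτ : s ⟨τ, hτG⟩ = -1)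
    (hτK : ∀ a : K, τ (algebraMap K H a) = algebraMap K H a) (hτt : τ t = -t)
    {u : K} {e : ℚ} (hu : u ∉ Set.range (algebraMap ℚ K)) (hue : u ^ 2 = algebraMap ℚ K e)
    (c : K ≃ₐ[ℚ] K) (hcu : c u = -u)
    [(V.quadraticTwist (-1)).IsElliptic] {C : VariableChange ℚ} (hC : C • W = V.quadraticTwist (-1))
    {P : (V.quadraticTwist (-1)).toAffine.Point}
    (hgen : ∀ R : (V.quadraticTwist (-1)).toAffine.Point,
      ∃ (k : ℤ) (T : (V.quadraticTwist (-1)).toAffine.Point), IsOfFinAddOrder T ∧ R = k • P + T)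
    (htors : ∀ Q : ((V.quadraticTwist (-1)).quadraticTwist e).toAffine.Point, IsOfFinAddOrder Q)
    (DH : PAdicHeightDataK V 2 H)
    (hDH : ∀ (σ : G) (a b : (V.baseChange H).toAffine.Point),
      DH.pairing (pointGalHom V H σ.1 a) (pointGalHom V H σ.1 b) = DH.pairing a b)
    {h₂ : ℚ_[2]}
    (hpin : DH.pairing
      (twistPointEquivOver V (not_mem_range_rat_of_not_mem_range htK) ht2
        (QuadraticDescent.incl H (V.quadraticTwist (-1)) P))
      (twistPointEquivOver V (not_mem_range_rat_of_not_mem_range htK) ht2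
        (QuadraticDescent.incl H (V.quadraticTwist (-1)) P)) = h₂)
    (hGZ : ChiLineGrossZagierClauses ι K V H f (ι (((unitRoot V 2 : ℚ_[2]) : PadicAlgCl 2)))
      (baseChangeDirichlet K (ZMod.χ₄.ringHomComp (Int.castRingHom ℂ))) 𝔭 𝔭' G χ DH)
    (hh₂ : h₂ ≠ 0) :
    (PowerSeries.coeff 1 (padicLFunctionTameBranch fE d.natAbs (unitRoot cm7 2 : ℚ_[2])
          ((χJ.ringHomComp (Int.castRingHom ℚ)).ringHomComp (Rat.castHom ℚ_[2])) 1)) ≠ 0 ∧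
    ∃ q : ℚ, shaAn W = (q : ℂ) ∧ q ≠ 0 ∧
      padicValRat 2 q + (padicValNat 2 W.tamagawaProduct : ℤ) + h₂.valuation =
        (PowerSeries.coeff 1 (padicLFunctionTameBranch fE d.natAbs (unitRoot cm7 2 : ℚ_[2])
          ((χJ.ringHomComp (Int.castRingHom ℚ)).ringHomComp (Rat.castHom ℚ_[2])) 1)).valuation + 2 +
          2 * (padicValNat 2 W.torsionOrder : ℤ) := by
  have hordE : IsOrdinaryAt cm7 2 := ⟨cm7_hasGoodReductionAtPrime_two, cm7_not_two_dvd_frobeniusTrace_two⟩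
  have hϖE := realPeriodRat_cm7_eq_plusPeriod hM hfE
  have hdQ : ((d : ℚ)) ≠ 0 := by exact_mod_cast hd0.ne
  have hΔ : V.Δ < 0 := Δ_neg_of_smul_eq_quadraticTwist cm7 V (by rw [Δ_cm7]; norm_num) hdQ hV
  obtain ⟨hDG, q, hq, hq0, hv⟩ := defectKey_chi4_base_currency_neg ι K hGZ73 h2 hsplit 𝔭 𝔭' h𝔭 h𝔭' κ hκ hκ2 hd cm7 hfE
    hordE hmodf hd0 hd4 hsq hcop hχJ one_ne_zero hϖE V V' hV hΔ hordV' hap hfV hfV' hV' h0 hmod W W' hg hg' hgε hg'ε hr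
    hrk hL' hKH htK ht2 G χ s hs τ hτG hsτ hτK hτt hu hue c hcu hC hgen htors DH hDH hpin hGZ hh₂
  have hu0 : padicValRat 2 (C₀.u : ℚ) = 0 := padicValRat_u_cm7_twist_eq_zero hd4 hsq h7 V hV
  refine ⟨hDG, q, hq, hq0, ?_⟩
  rw [hu0, add_zero, padicValRat_numRealComponents_cm7, add_zero, padicValRat.one, add_zero] at hv
  exact hv

/-! ### The `χ₋₈∘N`-class in `cm7`-currency -/

/-- ★★★ **The defect key of the `χ₋₈∘N`-class MODULO (Δ1), in `cm7`-currency, with NO class constant, `d > 0`** (object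
`D_G = Σ_k k[T^k]G(−2)^{k−1}`, `G = L⁻₂(f_{cm7}, d, α_{cm7}, ωχ_d, ·)`; `μ(cm7) = 1`, `u(C₀) = ±1` discharged):
`D_G ≠ 0 ∧ shaAn W = q ∈ ℚˣ ∧ v₂(q) + v₂(Tam W) + v₂(h₂) = v₂(D_G) + 2 + 2v₂(#W(ℚ)_tors)`.
[cite: Disegni2017, Theorem B] [cite: MazurTateTeitelbaum1986Invent, §I.8 and §I.13] [cite: Pal2012, Prop. 2.5, Thm. 3.2]
[cite: AgasheRibetStein2006, Thm. 2.6 and appendix §5] -/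
theorem defectKey_chi8'_cm7_currency (hGZ73 : GrossZagier1986_thm_I_7_3) (h2 : Module.finrank ℚ K = 2)
    (hsplit : ((Ideal.span {(2 : ℤ)}).primesOver (𝓞 K)).ncard = 2)
    (𝔭 𝔭' : HeightOneSpectrum (𝓞 K)) (h𝔭 : ((2 : ℕ) : 𝓞 K) ∈ 𝔭.asIdeal)
    (h𝔭' : ((2 : ℕ) : 𝓞 K) ∈ 𝔭'.asIdeal)
    (κ : DirichletCharacter ℂ (NumberField.discr K).natAbs)
    (hκ : ∀ ℓ : ℕ, ℓ.Prime → ℓ ≠ 2 → κ ℓ = (jacobiSym (NumberField.discr K) ℓ : ℂ))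
    (hκ2 : κ 2 = if NumberField.discr K % 8 = 1 then 1 else if NumberField.discr K % 8 = 5 then -1 else 0)
    (hd : Nat.Coprime 2 (NumberField.discr K).natAbs)
    -- the base `cm7`: anchor print, newform, and the twist parameter `d`
    [cm7.IsGloballyMinimal] [NeZero (cm7.conductorNorm ℤ)] (hM : OptimalCurveManinCertificate cm7)
    {fE : CuspForm (Gamma0 (cm7.conductorNorm ℤ)) 2} (hfE : IsNewformOf cm7 fE)
    (hmodf : exists_isNewformOf) {d : ℤ} [NeZero d.natAbs] (hd0 : 0 < d) (hd4 : d % 4 = 1) (hsq : Squarefree d)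
    (hcop : IsCoprime d (cm7.conductorNorm ℤ : ℤ)) (h7 : ¬ (7 : ℤ) ∣ d) {χJ : MulChar (ZMod d.natAbs) ℤ}
    (hχJ : ∀ a : ZMod d.natAbs, χJ a = J((a.val : ℤ) | d.natAbs))
    -- the good pair over `V = C₀ • cm7^{(d)}`
    (V V' : WeierstrassCurve ℚ) [V.IsElliptic] [V.IsGloballyMinimal] [V'.IsElliptic] [V'.IsGloballyMinimal]
    [NeZero (V.conductorNorm ℤ)] {C₀ : VariableChange ℚ} (hV : C₀ • cm7.quadraticTwist (d : ℚ) = V)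
    (hordV' : IsOrdinaryAt V' 2) (hap : V'.frobeniusTrace 2 = V.frobeniusTrace 2)
    {N' : ℕ} [NeZero N'] {f : CuspForm (Gamma0 (V.conductorNorm ℤ)) 2}
    {f' : CuspForm (Gamma0 N') 2} (hfV : IsNewformOf V f) (hfV' : IsNewformOf V' f')
    (hV' : ∀ n : ℕ, cuspCoeff f' n = κ (n : ZMod _) * cuspCoeff f n)
    (h0 : HasSum (fun k : ℕ ↦ PowerSeries.coeff k (padicLFunctionMinusBranch f (unitRoot V 2 : ℚ_[2]) 1) *
      (-2 : ℚ_[2]) ^ k) 0)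
    (hmod : hasEntireLFunction_rat) {M M' : ℕ} [NeZero M] [NeZero M']
    {g : CuspForm (Gamma0 M) 2} {g' : CuspForm (Gamma0 M') 2}
    (W W' : WeierstrassCurve ℚ) [W.IsElliptic] [W.IsGloballyMinimal] [W'.IsElliptic]
    (hg : IsNewformOf W g) (hg' : IsNewformOf W' g')
    (hgε : ∀ m : ℕ, cuspCoeff g m = (ZMod.χ₈'.ringHomComp (Int.castRingHom ℂ)) m * cuspCoeff f m)
    (hg'ε : ∀ m : ℕ, cuspCoeff g' m = (ZMod.χ₈'.ringHomComp (Int.castRingHom ℂ)) m * cuspCoeff f' m)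
    (hr : W.analyticRank = 1) (hrk : W.mordellWeilRank = 1) (hL' : W'.entireLFunction 1 ≠ 0)
    {H : Type} [Field H] [NumberField H] [Algebra K H] (hKH : Module.finrank K H = 2) {t : H}
    (htK : t ∉ Set.range (algebraMap K H)) (ht2 : t ^ 2 = algebraMap ℚ H (-2))
    (G : Subgroup (H ≃ₐ[ℚ] H)) (χ : G →* ℂˣ) (s : G → ℤ) (hs : ∀ σ, ((χ σ : ℂˣ) : ℂ) = (s σ : ℂ))
    (τ : H ≃ₐ[ℚ] H) (hτG : τ ∈ G) (hsτ : s ⟨τ, hτG⟩ = -1)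
    (hτK : ∀ a : K, τ (algebraMap K H a) = algebraMap K H a) (hτt : τ t = -t)
    {u : K} {e : ℚ} (hu : u ∉ Set.range (algebraMap ℚ K)) (hue : u ^ 2 = algebraMap ℚ K e)
    (c : K ≃ₐ[ℚ] K) (hcu : c u = -u)
    [(V.quadraticTwist (-2)).IsElliptic] {C : VariableChange ℚ} (hC : C • W = V.quadraticTwist (-2))
    {P : (V.quadraticTwist (-2)).toAffine.Point}
    (hgen : ∀ R : (V.quadraticTwist (-2)).toAffine.Point,
      ∃ (k : ℤ) (T : (V.quadraticTwist (-2)).toAffine.Point), IsOfFinAddOrder T ∧ R = k • P + T)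
    (htors : ∀ Q : ((V.quadraticTwist (-2)).quadraticTwist e).toAffine.Point, IsOfFinAddOrder Q)
    (DH : PAdicHeightDataK V 2 H)
    (hDH : ∀ (σ : G) (a b : (V.baseChange H).toAffine.Point),
      DH.pairing (pointGalHom V H σ.1 a) (pointGalHom V H σ.1 b) = DH.pairing a b)
    {h₂ : ℚ_[2]}
    (hpin : DH.pairing
      (twistPointEquivOver V (not_mem_range_rat_of_not_mem_range htK) ht2
        (QuadraticDescent.incl H (V.quadraticTwist (-2)) P))
      (twistPointEquivOver V (not_mem_range_rat_of_not_mem_range htK) ht2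
        (QuadraticDescent.incl H (V.quadraticTwist (-2)) P)) = h₂)
    (hGZ : ChiLineGrossZagierClauses ι K V H f (ι (((unitRoot V 2 : ℚ_[2]) : PadicAlgCl 2)))
      (baseChangeDirichlet K (ZMod.χ₈'.ringHomComp (Int.castRingHom ℂ))) 𝔭 𝔭' G χ DH)
    (hh₂ : h₂ ≠ 0) :
    (∑' k : ℕ, PowerSeries.coeff k (padicLFunctionTameMinusBranch fE d.natAbs (unitRoot cm7 2 : ℚ_[2])
          ((χJ.ringHomComp (Int.castRingHom ℚ)).ringHomComp (Rat.castHom ℚ_[2])) 1) * (k : ℚ_[2]) * (-2) ^ (k - 1)) ≠ 0 ∧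
    ∃ q : ℚ, shaAn W = (q : ℂ) ∧ q ≠ 0 ∧
      padicValRat 2 q + (padicValNat 2 W.tamagawaProduct : ℤ) + h₂.valuation =
        (∑' k : ℕ, PowerSeries.coeff k (padicLFunctionTameMinusBranch fE d.natAbs (unitRoot cm7 2 : ℚ_[2])
          ((χJ.ringHomComp (Int.castRingHom ℚ)).ringHomComp (Rat.castHom ℚ_[2])) 1) * (k : ℚ_[2]) * (-2) ^ (k - 1)).valuation + 2 +
          2 * (padicValNat 2 W.torsionOrder : ℤ) := by
  have hordE : IsOrdinaryAt cm7 2 := ⟨cm7_hasGoodReductionAtPrime_two, cm7_not_two_dvd_frobeniusTrace_two⟩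
  have hμE := imaginaryPeriodRat_cm7_eq_minusPeriod hM hfE
  have hdQ : ((d : ℚ)) ≠ 0 := by exact_mod_cast hd0.ne'
  have hΔ : V.Δ < 0 := Δ_neg_of_smul_eq_quadraticTwist cm7 V (by rw [Δ_cm7]; norm_num) hdQ hV
  obtain ⟨hDG, q, hq, hq0, hv⟩ := defectKey_chi8'_base_currency ι K hGZ73 h2 hsplit 𝔭 𝔭' h𝔭 h𝔭' κ hκ hκ2 hd cm7 hfE
    hordE hmodf hd0 hd4 hsq hcop hχJ one_ne_zero hμE V V' hV hΔ hordV' hap hfV hfV' hV' h0 hmod W W' hg hg' hgε hg'ε hr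
    hrk hL' hKH htK ht2 G χ s hs τ hτG hsτ hτK hτt hu hue c hcu hC hgen htors DH hDH hpin hGZ hh₂
  have hu0 : padicValRat 2 (C₀.u : ℚ) = 0 := padicValRat_u_cm7_twist_eq_zero hd4 hsq h7 V hV
  refine ⟨hDG, q, hq, hq0, ?_⟩
  rw [hu0, add_zero, padicValRat.one, add_zero] at hv
  exact hv

/-- ★★★ **The defect key of the `χ₋₈∘N`-class MODULO (Δ1), in `cm7`-currency, with NO class constant, `d < 0`** (object `D_G`
on the `ω`-branch of the `χ_d`-twisted PLUS tame transform of `f_{cm7}`; `ϖ(cm7) = 1`, `c_∞(cm7) = 1`, `u(C₀) = ±1` discharged):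
`D_G ≠ 0 ∧ shaAn W = q ∈ ℚˣ ∧ v₂(q) + v₂(Tam W) + v₂(h₂) = v₂(D_G) + 2 + 2v₂(#W(ℚ)_tors)`.
[cite: Disegni2017, Theorem B] [cite: MazurTateTeitelbaum1986Invent, §I.8 and §I.13] [cite: Pal2012, Prop. 2.5, Thm. 3.2]
[cite: AgasheRibetStein2006, Thm. 2.6 and appendix §5] -/
theorem defectKey_chi8'_cm7_currency_neg (hGZ73 : GrossZagier1986_thm_I_7_3) (h2 : Module.finrank ℚ K = 2)
    (hsplit : ((Ideal.span {(2 : ℤ)}).primesOver (𝓞 K)).ncard = 2)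
    (𝔭 𝔭' : HeightOneSpectrum (𝓞 K)) (h𝔭 : ((2 : ℕ) : 𝓞 K) ∈ 𝔭.asIdeal)
    (h𝔭' : ((2 : ℕ) : 𝓞 K) ∈ 𝔭'.asIdeal)
    (κ : DirichletCharacter ℂ (NumberField.discr K).natAbs)
    (hκ : ∀ ℓ : ℕ, ℓ.Prime → ℓ ≠ 2 → κ ℓ = (jacobiSym (NumberField.discr K) ℓ : ℂ))
    (hκ2 : κ 2 = if NumberField.discr K % 8 = 1 then 1 else if NumberField.discr K % 8 = 5 then -1 else 0)
    (hd : Nat.Coprime 2 (NumberField.discr K).natAbs)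
    -- the base `cm7`: anchor print, newform, and the twist parameter `d`
    [cm7.IsGloballyMinimal] [NeZero (cm7.conductorNorm ℤ)] (hM : OptimalCurveManinCertificate cm7)
    {fE : CuspForm (Gamma0 (cm7.conductorNorm ℤ)) 2} (hfE : IsNewformOf cm7 fE)
    (hmodf : exists_isNewformOf) {d : ℤ} [NeZero d.natAbs] (hd0 : d < 0) (hd4 : d % 4 = 1) (hsq : Squarefree d)
    (hcop : IsCoprime d (cm7.conductorNorm ℤ : ℤ)) (h7 : ¬ (7 : ℤ) ∣ d) {χJ : MulChar (ZMod d.natAbs) ℤ}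
    (hχJ : ∀ a : ZMod d.natAbs, χJ a = J((a.val : ℤ) | d.natAbs))
    -- the good pair over `V = C₀ • cm7^{(d)}`
    (V V' : WeierstrassCurve ℚ) [V.IsElliptic] [V.IsGloballyMinimal] [V'.IsElliptic] [V'.IsGloballyMinimal]
    [NeZero (V.conductorNorm ℤ)] {C₀ : VariableChange ℚ} (hV : C₀ • cm7.quadraticTwist (d : ℚ) = V)
    (hordV' : IsOrdinaryAt V' 2) (hap : V'.frobeniusTrace 2 = V.frobeniusTrace 2)
    {N' : ℕ} [NeZero N'] {f : CuspForm (Gamma0 (V.conductorNorm ℤ)) 2}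
    {f' : CuspForm (Gamma0 N') 2} (hfV : IsNewformOf V f) (hfV' : IsNewformOf V' f')
    (hV' : ∀ n : ℕ, cuspCoeff f' n = κ (n : ZMod _) * cuspCoeff f n)
    (h0 : HasSum (fun k : ℕ ↦ PowerSeries.coeff k (padicLFunctionMinusBranch f (unitRoot V 2 : ℚ_[2]) 1) *
      (-2 : ℚ_[2]) ^ k) 0)
    (hmod : hasEntireLFunction_rat) {M M' : ℕ} [NeZero M] [NeZero M']
    {g : CuspForm (Gamma0 M) 2} {g' : CuspForm (Gamma0 M') 2}
    (W W' : WeierstrassCurve ℚ) [W.IsElliptic] [W.IsGloballyMinimal] [W'.IsElliptic]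
    (hg : IsNewformOf W g) (hg' : IsNewformOf W' g')
    (hgε : ∀ m : ℕ, cuspCoeff g m = (ZMod.χ₈'.ringHomComp (Int.castRingHom ℂ)) m * cuspCoeff f m)
    (hg'ε : ∀ m : ℕ, cuspCoeff g' m = (ZMod.χ₈'.ringHomComp (Int.castRingHom ℂ)) m * cuspCoeff f' m)
    (hr : W.analyticRank = 1) (hrk : W.mordellWeilRank = 1) (hL' : W'.entireLFunction 1 ≠ 0)
    {H : Type} [Field H] [NumberField H] [Algebra K H] (hKH : Module.finrank K H = 2) {t : H}
    (htK : t ∉ Set.range (algebraMap K H)) (ht2 : t ^ 2 = algebraMap ℚ H (-2))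
    (G : Subgroup (H ≃ₐ[ℚ] H)) (χ : G →* ℂˣ) (s : G → ℤ) (hs : ∀ σ, ((χ σ : ℂˣ) : ℂ) = (s σ : ℂ))
    (τ : H ≃ₐ[ℚ] H) (hτG : τ ∈ G) (hsτ : s ⟨τ, hτG⟩ = -1)
    (hτK : ∀ a : K, τ (algebraMap K H a) = algebraMap K H a) (hτt : τ t = -t)
    {u : K} {e : ℚ} (hu : u ∉ Set.range (algebraMap ℚ K)) (hue : u ^ 2 = algebraMap ℚ K e)
    (c : K ≃ₐ[ℚ] K) (hcu : c u = -u)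
    [(V.quadraticTwist (-2)).IsElliptic] {C : VariableChange ℚ} (hC : C • W = V.quadraticTwist (-2))
    {P : (V.quadraticTwist (-2)).toAffine.Point}
    (hgen : ∀ R : (V.quadraticTwist (-2)).toAffine.Point,
      ∃ (k : ℤ) (T : (V.quadraticTwist (-2)).toAffine.Point), IsOfFinAddOrder T ∧ R = k • P + T)
    (htors : ∀ Q : ((V.quadraticTwist (-2)).quadraticTwist e).toAffine.Point, IsOfFinAddOrder Q)
    (DH : PAdicHeightDataK V 2 H)
    (hDH : ∀ (σ : G) (a b : (V.baseChange H).toAffine.Point),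
      DH.pairing (pointGalHom V H σ.1 a) (pointGalHom V H σ.1 b) = DH.pairing a b)
    {h₂ : ℚ_[2]}
    (hpin : DH.pairing
      (twistPointEquivOver V (not_mem_range_rat_of_not_mem_range htK) ht2
        (QuadraticDescent.incl H (V.quadraticTwist (-2)) P))
      (twistPointEquivOver V (not_mem_range_rat_of_not_mem_range htK) ht2
        (QuadraticDescent.incl H (V.quadraticTwist (-2)) P)) = h₂)
    (hGZ : ChiLineGrossZagierClauses ι K V H f (ι (((unitRoot V 2 : ℚ_[2]) : PadicAlgCl 2)))
      (baseChangeDirichlet K (ZMod.χ₈'.ringHomComp (Int.castRingHom ℂ))) 𝔭 𝔭' G χ DH)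
    (hh₂ : h₂ ≠ 0) :
    (∑' k : ℕ, PowerSeries.coeff k (padicLFunctionTameBranch fE d.natAbs (unitRoot cm7 2 : ℚ_[2])
          ((χJ.ringHomComp (Int.castRingHom ℚ)).ringHomComp (Rat.castHom ℚ_[2])) 1) * (k : ℚ_[2]) * (-2) ^ (k - 1)) ≠ 0 ∧
    ∃ q : ℚ, shaAn W = (q : ℂ) ∧ q ≠ 0 ∧
      padicValRat 2 q + (padicValNat 2 W.tamagawaProduct : ℤ) + h₂.valuation =
        (∑' k : ℕ, PowerSeries.coeff k (padicLFunctionTameBranch fE d.natAbs (unitRoot cm7 2 : ℚ_[2])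
          ((χJ.ringHomComp (Int.castRingHom ℚ)).ringHomComp (Rat.castHom ℚ_[2])) 1) * (k : ℚ_[2]) * (-2) ^ (k - 1)).valuation + 2 +
          2 * (padicValNat 2 W.torsionOrder : ℤ) := by
  have hordE : IsOrdinaryAt cm7 2 := ⟨cm7_hasGoodReductionAtPrime_two, cm7_not_two_dvd_frobeniusTrace_two⟩
  have hϖE := realPeriodRat_cm7_eq_plusPeriod hM hfE
  have hdQ : ((d : ℚ)) ≠ 0 := by exact_mod_cast hd0.ne
  have hΔ : V.Δ < 0 := Δ_neg_of_smul_eq_quadraticTwist cm7 V (by rw [Δ_cm7]; norm_num) hdQ hV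
  obtain ⟨hDG, q, hq, hq0, hv⟩ := defectKey_chi8'_base_currency_neg ι K hGZ73 h2 hsplit 𝔭 𝔭' h𝔭 h𝔭' κ hκ hκ2 hd cm7 hfE
    hordE hmodf hd0 hd4 hsq hcop hχJ one_ne_zero hϖE V V' hV hΔ hordV' hap hfV hfV' hV' h0 hmod W W' hg hg' hgε hg'ε hr
    hrk hL' hKH htK ht2 G χ s hs τ hτG hsτ hτK hτt hu hue c hcu hC hgen htors DH hDH hpin hGZ hh₂
  have hu0 : padicValRat 2 (C₀.u : ℚ) = 0 := padicValRat_u_cm7_twist_eq_zero hd4 hsq h7 V hV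
  refine ⟨hDG, q, hq, hq0, ?_⟩
  rw [hu0, add_zero, padicValRat_numRealComponents_cm7, add_zero, padicValRat.one, add_zero] at hv
  exact hv

end Summit.BirchSwinnertonDyer.BirchSwinnertonDyer.Theorems.PrintCf2.DisegniPairTwo

end
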